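import Summits.Ventures.HodgeRepro2.T5SU11SphericalGreen

/-!
# The Green's kernel: `(G f)(t) = ∫_a^b K(t, s) f(s) sinh 2s ds` with the symmetric kernel `K(t, s) = −φ(min(t, s)) χ(max(t, s))`

Row 451 wrote the Green's solution as `−χ(t) ∫_a^t φ f sinh 2s − φ(t) ∫_t^b χ f sinh 2s`. Splitting `∫_a^b` at `t` this is
the single integral

  **`(G f)(t) = ∫_a^b K(t, s) f(s) sinh 2s ds`,  `K(t, s) := −φ(min(t, s)) χ(max(t, s))`**  (`greenKernel`,
  `greenSol_eq_integral_kernel`, for `a ≤ t ≤ b`),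

whose kernel is **symmetric**, `K(t, s) = K(s, t)` (`greenKernel_symm`): the resolvent of the radial operator is an
integral operator with a symmetric kernel against the measure `sinh 2s ds` — the formal self-adjointness of the
radial Laplacian on `L²((0, ∞), sinh 2t dt)`. For the explicit model: `sphGreenKernel lam t s =
−φ_λ(a_{min(t,s)}) χ_λ(max(t, s))` and `(G_λ f)(t) = ∫_a^b sphGreenKernel lam t s · f(s) sinh 2s ds`
(`sphGreen_eq_integral_kernel`). Nothing is claimed about (N).

Blind lane: Mathlib + the HodgeRepro2 prefix only; no sorry; axioms ⊆ {propext, Classical.choice,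
Quot.sound}.
-/

namespace Summit.Ventures.HodgeRepro2.T5SU11RadialGreenKernel

open MeasureTheory intervalIntegral
open Set (Ioi uIcc Icc)
open T5SU11Cartan T5SU11SphericalFunction T5SU11ReductionOfOrder T5SU11SphericalSolutionSpaceAll
  T5SU11SphericalDecay T5SU11RadialGreen T5SU11SphericalGreen

/-- **The Green's kernel** `K(t, s) = −φ(min(t, s)) χ(max(t, s))`. -/
noncomputable def greenKernel (φ χ : ℝ → ℝ) (t s : ℝ) : ℝ := -(φ (min t s) * χ (max t s))

/-- **The kernel is symmetric.** -/
theorem greenKernel_symm (φ χ : ℝ → ℝ) (t s : ℝ) : greenKernel φ χ t s = greenKernel φ χ s t := by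
  unfold greenKernel
  rw [min_comm, max_comm]

/-- On `s ≤ t`: `K(t, s) = −φ(s) χ(t)`. -/
theorem greenKernel_of_le (φ χ : ℝ → ℝ) {t s : ℝ} (h : s ≤ t) : greenKernel φ χ t s = -(φ s * χ t) := by
  unfold greenKernel
  rw [min_eq_right h, max_eq_left h]

/-- On `t ≤ s`: `K(t, s) = −φ(t) χ(s)`. -/
theorem greenKernel_of_ge (φ χ : ℝ → ℝ) {t s : ℝ} (h : t ≤ s) : greenKernel φ χ t s = -(φ t * χ s) := by
  unfold greenKernel
  rw [min_eq_left h, max_eq_right h]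

section

variable {a b : ℝ} {φ φ' χ χ' f : ℝ → ℝ}
  (hφ : ∀ t, 0 < t → HasDerivAt φ (φ' t) t) (hχ : ∀ t, 0 < t → HasDerivAt χ (χ' t) t)
  (hf : ContinuousOn f (Ioi 0)) (ha : 0 < a)

include hφ hχ hf ha in
/-- **The Green's solution as an integral operator**: `(G f)(t) = ∫_a^b K(t, s) f(s) sinh 2s ds` for `a ≤ t ≤ b`. -/
theorem greenSol_eq_integral_kernel {t : ℝ} (hat : a ≤ t) (htb : t ≤ b) :
    greenSol φ χ f a b t = ∫ s in a..b, greenKernel φ χ t s * f s * Real.sinh (2 * s) := by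
  have ht : 0 < t := lt_of_lt_of_le ha hat
  have hb : 0 < b := lt_of_lt_of_le ht htb
  have hcφ := continuousOn_greenB_integrand hφ hf
  have hcχ := continuousOn_greenB_integrand hχ hf
  -- the two pieces of the kernel integral
  have h1 : ∫ s in a..t, greenKernel φ χ t s * f s * Real.sinh (2 * s)
      = -(χ t * greenB φ f a t) := by
    unfold greenB
    rw [← intervalIntegral.integral_const_mul, ← intervalIntegral.integral_neg]
    refine integral_congr (fun s hs => ?_)
    have hs' : s ≤ t := by
      rcases Set.mem_uIcc.mp hs with ⟨_, h2⟩ | ⟨_, h2⟩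
      · exact h2
      · exact le_trans h2 hat
    rw [greenKernel_of_le φ χ hs']
    ring
  have h2 : ∫ s in t..b, greenKernel φ χ t s * f s * Real.sinh (2 * s) = -(φ t * greenA χ f b t) := by
    unfold greenA
    rw [← intervalIntegral.integral_const_mul, ← intervalIntegral.integral_neg]
    refine integral_congr (fun s hs => ?_)
    have hs' : t ≤ s := by
      rcases Set.mem_uIcc.mp hs with ⟨h1, _⟩ | ⟨h1, _⟩
      · exact h1
      · exact le_trans htb h1
    rw [greenKernel_of_ge φ χ hs']
    ring
  -- integrability of the kernel integrand on the two pieces (it agrees with a continuous function there)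
  have hi1 : IntervalIntegrable (fun s => greenKernel φ χ t s * f s * Real.sinh (2 * s)) volume a t := by
    refine ContinuousOn.intervalIntegrable ?_
    refine ((hcφ.mono (uIcc_subset_Ioi ha ht)).mul (continuousOn_const (c := -χ t))).congr ?_
    intro s hs
    have hs' : s ≤ t := by
      rcases Set.mem_uIcc.mp hs with ⟨_, h2⟩ | ⟨_, h2⟩
      · exact h2
      · exact le_trans h2 hat
    show greenKernel φ χ t s * f s * Real.sinh (2 * s) = φ s * f s * Real.sinh (2 * s) * (-χ t)
    rw [greenKernel_of_le φ χ hs']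
    ring
  have hi2 : IntervalIntegrable (fun s => greenKernel φ χ t s * f s * Real.sinh (2 * s)) volume t b := by
    refine ContinuousOn.intervalIntegrable ?_
    refine ((hcχ.mono (uIcc_subset_Ioi ht hb)).mul (continuousOn_const (c := -φ t))).congr ?_
    intro s hs
    have hs' : t ≤ s := by
      rcases Set.mem_uIcc.mp hs with ⟨h1, _⟩ | ⟨h1, _⟩
      · exact h1
      · exact le_trans htb h1
    show greenKernel φ χ t s * f s * Real.sinh (2 * s) = χ s * f s * Real.sinh (2 * s) * (-φ t)
    rw [greenKernel_of_ge φ χ hs']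
    ring
  rw [← integral_add_adjacent_intervals hi1 hi2, h1, h2]
  unfold greenSol
  ring

end

section measure

variable [MeasurableSpace Circle] [BorelSpace Circle]

/-- **The Green's kernel of the explicit model**: `−φ_λ(a_{min(t,s)}) χ_λ(max(t, s))`. -/
noncomputable def sphGreenKernel (lam t s : ℝ) : ℝ := greenKernel (fun t => sph lam (hyp t)) (sphDecay lam) t s

omit [BorelSpace Circle] in
/-- The kernel is symmetric. -/
theorem sphGreenKernel_symm (lam t s : ℝ) : sphGreenKernel lam t s = sphGreenKernel lam s t :=
  greenKernel_symm _ _ t s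

/-- **`(G_λ f)(t) = ∫_a^b sphGreenKernel lam t s · f(s) sinh 2s ds`** for `λ > 1` and `a ≤ t ≤ b`. -/
theorem sphGreen_eq_integral_kernel {lam a b : ℝ} {f : ℝ → ℝ} (hlam : 1 < lam) (hf : ContinuousOn f (Ioi 0))
    (ha : 0 < a) {t : ℝ} (hat : a ≤ t) (htb : t ≤ b) :
    sphGreen lam f a b t = ∫ s in a..b, sphGreenKernel lam t s * f s * Real.sinh (2 * s) :=
  greenSol_eq_integral_kernel (hφ_sph lam) (fun _ ht => hasDerivAt_sphDecay hlam ht) hf ha hat htb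

end measure

end Summit.Ventures.HodgeRepro2.T5SU11RadialGreenKernel
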